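import Summits.AtomisticToContinuum.Crystallization.Theorems.FreeSplittingCertificatesStrictSplittingRuleP1Volume

/-!
# `StrictSplittingRule` (stmt-AtomisticToContinuum-12560): the far integrals DECOMPOSE OVER THE CELLS of the P1 interpolant (pairwise null overlaps; `∫ = Σ'_cells`) (P1 interpolant object, part 10)

Route `FreeSplittingCertificates`, crux r3 `StrictSplittingRule` (H12⋆ = `stub_coreJointCoercive`), unit b2b-freesplit-B gen 20.
VALUE = the bookkeeping identity with which the TRANSFER (item (2') of HOME FAR-LEMMA-SPEC §16 (c)) starts: the far ledger's integrals of the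
interpolant field become sums over the elements of the hcp honeycomb, element by element with a constant gradient.  NOT a proof of H12⋆, NOT
summit progress.

* `p1ChartHomeomorph` — the chart as a homeomorphism of `ℝ³` (`a, h ≠ 0`).
* `p1Cell_inter_subset_frontier` / `p1RealCell_inter_subset_frontier` — two DISTINCT cells meet only in the frontier of each (same cube: a
  barycentric coordinate vanishes, by conformity; different cubes: a cube face); hence `p1RealCell_aedisjoint` (pairwise a.e.-disjoint, the
  frontiers being null by `volume_frontier_p1RealCell`).
* **`integral_eq_tsum_p1RealCell`**: for every integrable `f`, `∫ f = Σ'_i ∫_{cell i} f`.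
* **`integral_fpDen_eq_tsum`**: `∫ χ²·Den(x, ∇v) dx = Σ'_i fpRec(G_i − A) · ∫_{cell i} χ²|x|⁻⁶` for the far-ledger field `v = p1Disp a h U b₀ A` (given
  integrability of the integrand, which the P1-class theory of gen 18 supplies) — receipts = Σ over elements of (constant-gradient receipts form) ×
  (element weight integral), the left side of the matched-weight comparison.
[folklore]
-/

noncomputable section

open Set Function Metric MeasureTheory Filter Topology
open scoped ENNReal

namespace Summit.AtomisticToContinuum.Crystallization.Theorems.StrictSplittingRuleBirth

/-! ## The chart as a homeomorphism -/

/-- The chart `T` as a homeomorphism of `ℝ³` (for `a, h ≠ 0`). -/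
def p1ChartHomeomorph {a h : ℝ} (ha : a ≠ 0) (hh : h ≠ 0) : (Fin 3 → ℝ) ≃ₜ (Fin 3 → ℝ) where
  toFun := p1Chart a h
  invFun := p1ChartInv a h
  left_inv := p1ChartInv_p1Chart ha hh
  right_inv := p1Chart_p1ChartInv ha hh
  continuous_toFun := continuous_p1Chart a h
  continuous_invFun := continuous_p1ChartInv a h

/-- The real cell is the preimage of the chart cell under the inverse homeomorphism. -/
theorem p1RealCell_eq_preimage_symm {a h : ℝ} (ha : a ≠ 0) (hh : h ≠ 0) (i : (ℤ × ℤ × ℤ) × Fin 6) :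
    p1RealCell a h i = (p1ChartHomeomorph ha hh).symm ⁻¹' p1Cell i := rfl

/-! ## Distinct cells meet in their frontiers -/

/-- On a piece, the difference of two vertices raises the barycentric coordinate of the first by exactly `1`:
`λ_m(p + t(v_m − v_{m'})) = λ_m(p) + t` for `m ≠ m'`. -/
theorem p1Bary_add_smul_vert_sub (e : Bool) (π : Fin 6) {m m' : Fin 4} (hmm : m ≠ m') (p : Fin 3 → ℝ) (t : ℝ) :
    p1Bary e π m (p + t • (p1Vec (p1VertOff e π m) - p1Vec (p1VertOff e π m'))) = p1Bary e π m p + t := by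
  have h1 := p1Bary_add e π m (p1Vec (p1VertOff e π m')) (p1Vec (p1VertOff e π m) - p1Vec (p1VertOff e π m'))
  rw [add_sub_cancel, p1Bary_vert, p1Bary_vert, if_pos rfl, if_neg hmm, zero_add] at h1
  rw [p1Bary_add, map_smul, smul_eq_mul, ← h1, mul_one]

/-- **Same cube, distinct pieces**: a common point is not interior to the first piece (a barycentric coordinate of it vanishes there). -/
theorem not_mem_interior_p1Cell_of_ne_piece {n : ℤ × ℤ × ℤ} {π π' : Fin 6} (hne : π ≠ π') {q : Fin 3 → ℝ}
    (hq : q ∈ p1Cell (n, π)) (hq' : q ∈ p1Cell (n, π')) : q ∉ interior (p1Cell (n, π)) := by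
  intro hint
  obtain ⟨m, m', hv, hpar⟩ := p1Vert_nonvert_of_ne (p1Par n) π π' hne
  -- the barycentric coordinate `m` of piece `π` vanishes at `q`
  have hzero : p1Bary (p1Par n) π m (q - p1Vec n) = 0 := by
    rw [← p1Hat_vert (p1Par n) π m hq, hpar, hv]
    exact p1Hat_nonvert (p1Par n) π' m' hq'
  -- pick another vertex `m''` of piece `π` and move towards `v_{m''} − v_m`
  obtain ⟨m'', hm''⟩ : ∃ m'' : Fin 4, m'' ≠ m := ⟨m + 1, by
    intro h; have := congrArg (fun x : Fin 4 => x - m) h; simp at this⟩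
  obtain ⟨r, hr, hball⟩ := Metric.isOpen_iff.1 isOpen_interior q hint
  set d : Fin 3 → ℝ := p1Vec (p1VertOff (p1Par n) π m) - p1Vec (p1VertOff (p1Par n) π m'') with hd
  have hdn : ‖d‖ ≤ 1 := by
    refine (pi_norm_le_iff_of_nonneg zero_le_one).2 fun j => ?_
    have h1 := p1VertOff_mem (p1Par n) π m
    have h2 := p1VertOff_mem (p1Par n) π m''
    rw [hd, Real.norm_eq_abs]
    fin_cases j
    · simp only [Pi.sub_apply, Fin.zero_eta, p1Vec_zero]
      rcases h1.1 with e1 | e1 <;> rcases h2.1 with e2 | e2 <;> simp [e1, e2]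
    · simp only [Pi.sub_apply, Fin.mk_one, p1Vec_one]
      rcases h1.2.1 with e1 | e1 <;> rcases h2.2.1 with e2 | e2 <;> simp [e1, e2]
    · simp only [Pi.sub_apply, Fin.reduceFinMk, p1Vec_two]
      rcases h1.2.2 with e1 | e1 <;> rcases h2.2.2 with e2 | e2 <;> simp [e1, e2]
  set q' : Fin 3 → ℝ := q + (-(r / 2)) • d with hq'd
  have hq'ball : q' ∈ ball q r := by
    rw [mem_ball, dist_eq_norm, hq'd, add_sub_cancel_left, norm_smul, Real.norm_eq_abs, abs_neg, abs_of_pos (by linarith)]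
    nlinarith [norm_nonneg d]
  have hq'cell : q' ∈ p1Cell (n, π) := interior_subset (hball hq'ball)
  have hneg : p1Bary (p1Par n) π m (q' - p1Vec n) = -(r / 2) := by
    have : q' - p1Vec n = (q - p1Vec n) + (-(r / 2)) • d := by rw [hq'd]; abel
    rw [this, hd, p1Bary_add_smul_vert_sub _ _ hm''.symm, hzero, zero_add]
  have := hq'cell m
  simp only at this
  linarith

/-- **Different cubes**: a point of two cells with different cube origins is not interior to the first (it lies on a cube face). -/
theorem not_mem_interior_p1Cell_of_ne_cube {n n' : ℤ × ℤ × ℤ} (hne : n ≠ n') {π π' : Fin 6} {q : Fin 3 → ℝ}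
    (hq : q ∈ p1Cell (n, π)) (hq' : q ∈ p1Cell (n', π')) : q ∉ interior (p1Cell (n, π)) := by
  intro hint
  obtain ⟨r, hr, hball⟩ := Metric.isOpen_iff.1 isOpen_interior q hint
  have hc := p1Cell_subset_cube hq
  have hc' := p1Cell_subset_cube hq'
  -- a coordinate `j` where the cube origins differ
  have hj : ∃ j : Fin 3, p1Vec n j ≠ p1Vec n' j := by
    by_contra hcon
    push Not at hcon
    apply hne
    have h0 : n.1 = n'.1 := by have := hcon 0; simp only [p1Vec_zero] at this; exact_mod_cast this
    have h1 : n.2.1 = n'.2.1 := by have := hcon 1; simp only [p1Vec_one] at this; exact_mod_cast this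
    have h2 : n.2.2 = n'.2.2 := by have := hcon 2; simp only [p1Vec_two] at this; exact_mod_cast this
    exact Prod.ext h0 (Prod.ext h1 h2)
  obtain ⟨j, hj⟩ := hj
  -- integrality: the origins differ by exactly one in coordinate `j` and `q_j` sits on the common face
  have hint_j : ∃ z z' : ℤ, (p1Vec n j = z) ∧ (p1Vec n' j = z') := by
    fin_cases j
    · exact ⟨n.1, n'.1, rfl, rfl⟩
    · exact ⟨n.2.1, n'.2.1, rfl, rfl⟩
    · exact ⟨n.2.2, n'.2.2, rfl, rfl⟩
  obtain ⟨z, z', hz, hz'⟩ := hint_j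
  have h1 := (hc j).1; have h2 := (hc j).2; have h3 := (hc' j).1; have h4 := (hc' j).2
  rw [hz] at h1 h2 hj; rw [hz'] at h3 h4 hj
  have hzz : z ≠ z' := fun h => hj (by rw [h])
  -- either `q_j = z` (then move down) or `q_j = z + 1` (then move up)
  have hface : q j = z ∨ q j = z + 1 := by
    rcases lt_or_gt_of_ne hzz with hlt | hgt
    · have : z + 1 ≤ z' := by omega
      have : (z : ℝ) + 1 ≤ z' := by exact_mod_cast this
      right; linarith
    · have : z' + 1 ≤ z := by omega
      have : (z' : ℝ) + 1 ≤ z := by exact_mod_cast this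
      left; linarith
  -- the point moved by `r/2` along `∓e_j` stays in the ball but leaves the cube `n`
  rcases hface with hq0 | hq1
  · set q'' : Fin 3 → ℝ := q - (r / 2) • fpE j with hq''
    have hb : q'' ∈ ball q r := by
      rw [mem_ball, dist_eq_norm, hq'', sub_sub_cancel_left, norm_neg, norm_smul, Real.norm_eq_abs, abs_of_pos (by linarith)]
      have : ‖fpE j‖ = 1 := by
        refine le_antisymm ((pi_norm_le_iff_of_nonneg zero_le_one).2 fun k => ?_) ?_
        · by_cases hk : k = j <;> simp [fpE, hk]
        · simpa [fpE] using norm_le_pi_norm (fpE j) j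
      rw [this]; linarith
    have hmem := p1Cell_subset_cube (interior_subset (hball hb)) j
    rw [hz] at hmem
    have : q'' j = q j - r / 2 := by simp [hq'', fpE]
    linarith [hmem.1]
  · set q'' : Fin 3 → ℝ := q + (r / 2) • fpE j with hq''
    have hb : q'' ∈ ball q r := by
      rw [mem_ball, dist_eq_norm, hq'', add_sub_cancel_left, norm_smul, Real.norm_eq_abs, abs_of_pos (by linarith)]
      have : ‖fpE j‖ = 1 := by
        refine le_antisymm ((pi_norm_le_iff_of_nonneg zero_le_one).2 fun k => ?_) ?_
        · by_cases hk : k = j <;> simp [fpE, hk]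
        · simpa [fpE] using norm_le_pi_norm (fpE j) j
      rw [this]; linarith
    have hmem := p1Cell_subset_cube (interior_subset (hball hb)) j
    rw [hz] at hmem
    have : q'' j = q j + r / 2 := by simp [hq'', fpE]
    linarith [hmem.2]

/-- **Distinct chart cells meet in the frontier of each.** -/
theorem p1Cell_inter_subset_frontier {i i' : (ℤ × ℤ × ℤ) × Fin 6} (hne : i ≠ i') : p1Cell i ∩ p1Cell i' ⊆ frontier (p1Cell i) := by
  rintro q ⟨hq, hq'⟩
  rw [(isClosed_p1Cell i).frontier_eq]
  refine ⟨hq, ?_⟩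
  obtain ⟨n, π⟩ := i
  obtain ⟨n', π'⟩ := i'
  by_cases hn : n = n'
  · subst hn
    have hπ : π ≠ π' := fun h => hne (by rw [h])
    exact not_mem_interior_p1Cell_of_ne_piece hπ hq hq'
  · exact not_mem_interior_p1Cell_of_ne_cube hn hq hq'

/-- **Distinct real cells meet in the frontier of each.** -/
theorem p1RealCell_inter_subset_frontier {a h : ℝ} (ha : a ≠ 0) (hh : h ≠ 0) {i i' : (ℤ × ℤ × ℤ) × Fin 6} (hne : i ≠ i') :
    p1RealCell a h i ∩ p1RealCell a h i' ⊆ frontier (p1RealCell a h i) := by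
  rintro y ⟨hy, hy'⟩
  rw [p1RealCell_eq_preimage_symm ha hh, ← (p1ChartHomeomorph ha hh).symm.preimage_frontier]
  exact p1Cell_inter_subset_frontier hne ⟨hy, hy'⟩

/-- **The real cells are pairwise a.e.-disjoint.** -/
theorem p1RealCell_aedisjoint {a h : ℝ} (ha : a ≠ 0) (hh : h ≠ 0) :
    Pairwise (AEDisjoint volume on p1RealCell a h) := fun i _ hne =>
  measure_mono_null (p1RealCell_inter_subset_frontier ha hh hne) (volume_frontier_p1RealCell ha hh i)

/-- The real cells cover `ℝ³`. -/
theorem iUnion_p1RealCell (a h : ℝ) : (⋃ i, p1RealCell a h i) = univ :=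
  eq_univ_of_forall fun y => mem_iUnion.2 (exists_p1RealCell a h y)

/-! ## Integrals as sums over cells -/

/-- **Every integral is the sum of its cell integrals**: `∫ f = Σ'_i ∫_{cell i} f` for integrable `f`. -/
theorem integral_eq_tsum_p1RealCell {a h : ℝ} (ha : a ≠ 0) (hh : h ≠ 0) {F : Type*} [NormedAddCommGroup F] [NormedSpace ℝ F]
    {f : (Fin 3 → ℝ) → F} (hf : Integrable f) : ∫ x, f x = ∑' i, ∫ x in p1RealCell a h i, f x := by
  rw [← setIntegral_univ, ← iUnion_p1RealCell a h]
  refine integral_iUnion_ae (fun i => (isClosed_p1RealCell a h i).measurableSet.nullMeasurableSet) (p1RealCell_aedisjoint ha hh) ?_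
  rw [iUnion_p1RealCell]
  exact hf.integrableOn

/-- **The receipts integral as a sum over elements**: `∫ χ²·Den(x, ∇v) = Σ'_i fpRec(G_i − A) · ∫_{cell i} χ²|x|⁻⁶` for the far-ledger field
`v = p1Disp a h U b₀ A` (integrability of the integrand assumed). -/
theorem integral_fpDen_eq_tsum {a h : ℝ} (ha : a ≠ 0) (hh : h ≠ 0) (U : ℤ × ℤ × ℤ → (Fin 3 → ℝ)) (b₀ : Fin 3 → ℝ) (A : Fin 3 → Fin 3 → ℝ)
    (χ : (Fin 3 → ℝ) → ℝ) (hint : Integrable fun x => χ x ^ 2 * fpDen x (fpGrad (p1Disp a h U b₀ A) x)) :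
    ∫ x, χ x ^ 2 * fpDen x (fpGrad (p1Disp a h U b₀ A) x) =
      ∑' i, fpRec (fun j k => p1CellGrad a h U i j k - A j k) * ∫ x in p1RealCell a h i, χ x ^ 2 * (fpSq x)⁻¹ ^ 3 := by
  rw [integral_eq_tsum_p1RealCell ha hh hint]
  exact tsum_congr fun i => setIntegral_p1RealCell_fpDen ha hh U b₀ A i χ

/-- **General form**: `∫ w(x)·g(∇v(x)) = Σ'_i g(G_i − A) · ∫_{cell i} w` for any weight `w` and gradient functional `g` (integrability assumed). -/
theorem integral_weight_fpGrad_eq_tsum {a h : ℝ} (ha : a ≠ 0) (hh : h ≠ 0) (U : ℤ × ℤ × ℤ → (Fin 3 → ℝ)) (b₀ : Fin 3 → ℝ)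
    (A : Fin 3 → Fin 3 → ℝ) (w : (Fin 3 → ℝ) → ℝ) (g : (Fin 3 → Fin 3 → ℝ) → ℝ)
    (hint : Integrable fun x => w x * g (fpGrad (p1Disp a h U b₀ A) x)) :
    ∫ x, w x * g (fpGrad (p1Disp a h U b₀ A) x) =
      ∑' i, g (fun j k => p1CellGrad a h U i j k - A j k) * ∫ x in p1RealCell a h i, w x := by
  rw [integral_eq_tsum_p1RealCell ha hh hint]
  exact tsum_congr fun i => setIntegral_p1RealCell_weight_fpGrad ha hh U b₀ A i w g

end Summit.AtomisticToContinuum.Crystallization.Theorems.StrictSplittingRuleBirth
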